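import Literature.NumberTheory.LFunctions.ConreyIwaniec2002Thm61Partition
import Literature.NumberTheory.LFunctions.ConreyIwaniec2002Thm61Bumps
import Literature.NumberTheory.LFunctions.ConreyIwaniec2002Thm61ShiftedArith
import HarnessLib

/-!
# Conrey–Iwaniec (2002), Theorem 6.1, (6.27): the pieces of `S*(h)` on the smooth `ρ`-adic partition

B. Conrey, H. Iwaniec, Acta Arith. 103 (2002), §6 (6.27) [held text `paper:arxiv-math_0111012`,
p0015:L52–80]. With `ρ = 9/8`, the constituents `η_k = plateau ρ (ρ^k/ρ) (ρ^k)` (support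
`[ρ^{k-1}, ρ^{k+1}]`) of the partition of unity of `ConreyIwaniec2002Thm61Partition` are inserted in
the variable `m = n + h` of
`S*(h) = Σ_n λ(n+h)a(n+h)·conj(λ(n)a(n))·L(hT/n)` (6.9) and of `∫₀^∞ a(x+h)ā(x)L(hT/x)dx`:

* **non-separated pieces** (`h ≤ ρ^{k-1} − ρ^{k-2}`): with the fattening
  `θ_k = plateau ρ X_k ρ^{k+1}` (`= 1` on `[ρ^{k-2}, ρ^{k+1}] ⊇ supp η_k − h`, `X_k = ρ^{k-3}`), the
  `k`-th piece of the sum / integral is exactly the left side of (6.19) for the test functions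
  `g₁ = η_k·a/(4PW_k)`, `g₂ = θ_k·ā·L(hT/·)/(48PW_k)` on `[X_k, 2X_k]` (`W_k = (1+X_k/Y)⁻⁴`), so
  `|S_k − σ(h)I_k| ≤ 192P²W_k²·Bτ(h)X_k^{3/4}log²(3X_k)` (`piece_bound`), and the sum over these
  pieces is `≪ P²Bτ(h)Y^{3/4}log²(3Y)` (`large_block_bound`) — the first error term of (6.27);
* the **separated pieces** (`ρ^N ≤ 12h`, trivial bounds; second and third error terms of (6.27))
  are treated in `ConreyIwaniec2002Thm61ShiftedSmall.lean`.

PROVED HERE (namespace `ConreyIwaniec2002.Thm61ShiftedPieces`), no `sorry`, no `def`; for the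
registered stub S2b `stub_thm61_shifted` of SKELETON P64 (line `thm61-cm-convolution`).

## References
* [ConreyIwaniec2002] B. Conrey, H. Iwaniec, Acta Arith. 103 (2002) 259–312: §6 (6.9), (6.14),
  (6.19), (6.27).
-/

noncomputable section

open Set Filter MeasureTheory
open scoped Topology

namespace Literature.NumberTheory.LFunctions

namespace ConreyIwaniec2002

namespace Thm61ShiftedPieces

open Thm61Partition Thm61Bumps Thm61ShiftedArith

/-! ### Numerics of `ρ = 9/8` -/

/-- `ρ = 9/8`: `1 < ρ`, `ρ⁴ ≤ 2`, `ρ⁵ ≤ 2`, `ρ⁻¹ − ρ⁻² = 8/81`, `ρ³ = 729/512`.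
[cite: ConreyIwaniec2002, §6 (6.27)] -/
theorem rho_facts {ρ : ℝ} (hρ : ρ = 9 / 8) :
    1 < ρ ∧ 0 < ρ ∧ ρ ^ 4 ≤ 2 ∧ ρ ^ 5 ≤ 2 ∧ ρ ^ 3 = 729 / 512 := by
  subst hρ; norm_num

/-! ### The weight bounds on a dyadic segment -/

/-- On `[X, 2X]` (`X > 0`): `‖a‖, x‖a′‖, x²‖a″‖ ≤ W = (1 + X/Y)⁻⁴` for `a` in the class (6.14).
[cite: ConreyIwaniec2002, §6 (6.14)] -/
theorem a_bounds_on {a : ℝ → ℂ} {Y : ℝ} (ha : IsCutoff14 a Y) (hY : 0 < Y) {X : ℝ} (hX : 0 < X)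
    {x : ℝ} (hx : x ∈ Icc X (2 * X)) :
    ‖a x‖ ≤ ((1 + X / Y) ^ 4)⁻¹ ∧ x * ‖iteratedDeriv 1 a x‖ ≤ ((1 + X / Y) ^ 4)⁻¹ ∧
      x ^ 2 * ‖iteratedDeriv 2 a x‖ ≤ ((1 + X / Y) ^ 4)⁻¹ := by
  have hx0 : 0 < x := lt_of_lt_of_le hX hx.1
  have hW : ((1 + x / Y) ^ 4)⁻¹ ≤ ((1 + X / Y) ^ 4)⁻¹ := by
    apply inv_anti₀ (by positivity)
    apply pow_le_pow_left₀ (by positivity)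
    have : X / Y ≤ x / Y := div_le_div_of_nonneg_right hx.1 hY.le
    linarith
  refine ⟨?_, ?_, ?_⟩
  · have h := ha.2 0 (by norm_num) x hx0
    rw [pow_zero, one_mul, iteratedDeriv_zero] at h
    exact h.trans hW
  · have h := ha.2 1 (by norm_num) x hx0
    rw [pow_one] at h
    exact h.trans hW
  · exact (ha.2 2 le_rfl x hx0).trans hW

/-- On `[X, 2X]`: the factor `b = ā·L(c/·)` has `‖b‖, x‖b′‖, x²‖b″‖ ≤ 12W`.
[cite: ConreyIwaniec2002, §6 (6.14), (6.27)] -/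
theorem conj_ell_bounds_on {K : ℝ → ℝ} (hK : IsCIKernel K) {a : ℝ → ℂ} {Y : ℝ} (ha : IsCutoff14 a Y)
    (hY : 0 < Y) {c : ℝ} (hc : 0 < c) {X : ℝ} (hX : 0 < X) {x : ℝ} (hx : x ∈ Icc X (2 * X)) :
    ‖starRingEnd ℂ (a x) * ((ciL K (c / x) : ℝ) : ℂ)‖ ≤ 12 * ((1 + X / Y) ^ 4)⁻¹ ∧
      x * ‖iteratedDeriv 1 (fun y => starRingEnd ℂ (a y) * ((ciL K (c / y) : ℝ) : ℂ)) x‖ ≤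
        12 * ((1 + X / Y) ^ 4)⁻¹ ∧
      x ^ 2 * ‖iteratedDeriv 2 (fun y => starRingEnd ℂ (a y) * ((ciL K (c / y) : ℝ) : ℂ)) x‖ ≤
        12 * ((1 + X / Y) ^ 4)⁻¹ := by
  have hx0 : 0 < x := lt_of_lt_of_le hX hx.1
  set W : ℝ := ((1 + X / Y) ^ 4)⁻¹ with hW
  have hW0 : 0 ≤ W := by positivity
  obtain ⟨ha0, ha1, ha2⟩ := a_bounds_on ha hY hX hx
  obtain ⟨hℓc, hℓ⟩ := ell_bounds hK hc
  obtain ⟨hl0, hl1, hl2⟩ := hℓ x hx0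
  have hf0 : ‖starRingEnd ℂ (a x)‖ ≤ W := by rwa [Complex.norm_conj]
  have hf1 : x * ‖iteratedDeriv 1 (fun y => starRingEnd ℂ (a y)) x‖ ≤ W := by
    rwa [norm_iteratedDeriv_conj a hx0]
  have hf2 : x ^ 2 * ‖iteratedDeriv 2 (fun y => starRingEnd ℂ (a y)) x‖ ≤ W := by
    rwa [norm_iteratedDeriv_conj a hx0]
  obtain ⟨h0, h1, h2⟩ := leibniz_Ioi (contDiffOn_conj ha.1) hℓc hx0 hf0 hf1 hf2 hl0 hl1 hl2
  refine ⟨h0.trans (by nlinarith), h1.trans (by nlinarith), h2.trans (by nlinarith)⟩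

/-! ### The non-separated pieces: (6.19) applies -/

section Piece

variable {ρ : ℝ} (hρ : ρ = 9 / 8) {K : ℝ → ℝ} (hK : IsCIKernel K)
  {lam : ℕ → ℂ} {σ : ℕ → ℝ} {B₁ : ℝ} (hS : ShiftedConvolutionBound lam σ B₁)
  {T Y : ℝ} {a : ℝ → ℂ} (hT : 1 ≤ T) (hY : 2 ≤ Y) (ha : IsCutoff14 a Y) (ha0 : a 0 = 0)
  {h : ℕ} (hh : 1 ≤ h) {D : ℝ} (hD1 : 1 ≤ D)
  (hD : ∀ u v : ℝ, 0 < u → u ≤ v → ∀ m : ℕ, m ≤ 2 → ∀ x : ℝ,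
      |x| ^ m * |iteratedDeriv m (plateau ρ u v) x| ≤ ρ ^ 2 * D * (1 + (v / u) ^ 2))

include hρ hh in
/-- For a non-separated piece (`h ≤ ρ^{k-1} − ρ^{k-2}`): `ρ^k ≥ 81/8`, `X_k = ρ^{k-3} ≥ 64/9`.
[cite: ConreyIwaniec2002, §6 (6.27)] -/
theorem piece_scale {k : ℕ} (hk : (h : ℝ) ≤ ρ ^ k / ρ - ρ ^ k / ρ ^ 2) :
    81 / 8 ≤ ρ ^ k ∧ 64 / 9 ≤ (ρ ^ 3)⁻¹ * ρ ^ k := by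
  obtain ⟨hρ1, hρ0, -, -, hρ3⟩ := rho_facts hρ
  have hh1 : (1:ℝ) ≤ h := by exact_mod_cast hh
  have e : ρ ^ k / ρ - ρ ^ k / ρ ^ 2 = ρ ^ k * (8 / 81) := by
    rw [div_eq_mul_inv, div_eq_mul_inv, ← mul_sub]
    congr 1
    rw [hρ]; norm_num
  rw [e] at hk
  constructor
  · nlinarith
  · rw [hρ3]; nlinarith

include hρ in
/-- If `η_k(n + h) ≠ 0` and the piece is non-separated then `θ_k(n) = 1`
(`n ≥ ρ^{k-1} − h ≥ ρ^{k-2}`, `n ≤ n + h ≤ ρ^{k+1}`). [cite: ConreyIwaniec2002, §6 (6.27)] -/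
theorem theta_eq_one {k : ℕ} (hk : (h : ℝ) ≤ ρ ^ k / ρ - ρ ^ k / ρ ^ 2) {x : ℝ}
    (hη : plateau ρ (ρ ^ k / ρ) (ρ ^ k) (x + h) ≠ 0) :
    plateau ρ ((ρ ^ 3)⁻¹ * ρ ^ k) (ρ ^ (k + 1)) x = 1 := by
  obtain ⟨hρ1, hρ0, -, -, -⟩ := rho_facts hρ
  have hρk : 0 < ρ ^ k := pow_pos hρ0 k
  have hu : 0 < ρ ^ k / ρ := by positivity
  have huv : ρ ^ k / ρ ≤ ρ ^ k := div_le_self hρk.le hρ1.le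
  have hmem : x + h ∈ Icc (ρ ^ k / ρ) (ρ * ρ ^ k) := by
    by_contra hc
    exact hη (plateau_eq_zero_of_not_mem hρ1 hu huv hc)
  refine plateau_eq_one hρ1 (by positivity) (by positivity) ?_ ?_
  · have e : ρ * ((ρ ^ 3)⁻¹ * ρ ^ k) = ρ ^ k / ρ ^ 2 := by field_simp
    rw [e]; linarith [hmem.1]
  · have h0 : (0:ℝ) ≤ h := Nat.cast_nonneg h
    rw [pow_succ]; linarith [hmem.2]

include hρ hK hS hT hY ha ha0 hh hD1 hD in
/-- **The non-separated piece `k` via (6.19)**: with `X_k = ρ^{k-3}`, `W_k = (1+X_k/Y)⁻⁴`,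
`P = ρ²D(1+ρ⁸)`,
`|Σ_n λ(n+h)a(n+h)conj(λ(n)a(n))L(hT/n)η_k(n+h) − σ(h)∫₀^∞ a(x+h)ā(x)L(hT/x)η_k(x+h)dx|
  ≤ 192P²·Bτ(h)·X_k^{3/4}log²(3X_k)(1+X_k/Y)⁻⁸`. [cite: ConreyIwaniec2002, §6 (6.19), (6.27)] -/
theorem piece_bound (k : ℕ) (hk : (h : ℝ) ≤ ρ ^ k / ρ - ρ ^ k / ρ ^ 2) :
    ‖(∑' n : ℕ, lam (n + h) * a ((n : ℝ) + h) * starRingEnd ℂ (lam n * a n) *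
          (ciL K (h * T / n) : ℂ) * (plateau ρ (ρ ^ k / ρ) (ρ ^ k) ((n : ℝ) + h) : ℂ)) -
        (σ h : ℂ) * ∫ x in Ioi (0:ℝ), a (x + h) * starRingEnd ℂ (a x) * (ciL K (h * T / x) : ℂ) *
          (plateau ρ (ρ ^ k / ρ) (ρ ^ k) (x + h) : ℂ)‖ ≤
      192 * (ρ ^ 2 * D * (1 + ρ ^ 8)) ^ 2 * B₁ * (Nat.divisors h).card *
        (((ρ ^ 3)⁻¹ * ρ ^ k) ^ (3 / 4 : ℝ) * Real.log (3 * ((ρ ^ 3)⁻¹ * ρ ^ k)) ^ 2 *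
          ((1 + (ρ ^ 3)⁻¹ * ρ ^ k / Y) ^ 8)⁻¹) := by
  obtain ⟨hρ1, hρ0, hρ4, hρ5, hρ3⟩ := rho_facts hρ
  obtain ⟨hρk81, hX64⟩ := piece_scale hρ hh hk
  set X : ℝ := (ρ ^ 3)⁻¹ * ρ ^ k with hXdef
  set P : ℝ := ρ ^ 2 * D * (1 + ρ ^ 8) with hPdef
  set W : ℝ := ((1 + X / Y) ^ 4)⁻¹ with hWdef
  have hY0 : 0 < Y := by linarith
  have hρk : 0 < ρ ^ k := pow_pos hρ0 k
  have hX0 : 0 < X := by positivity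
  have hXhalf : 1 / 2 ≤ X := by linarith
  have hW0 : 0 < W := by positivity
  have hD0 : 0 < D := by linarith
  have hP0 : 0 < P := by positivity
  have hc : 0 < (h : ℝ) * T := by
    have : (1:ℝ) ≤ h := by exact_mod_cast hh
    positivity
  -- the supports
  have hu₁ : 0 < ρ ^ k / ρ := by positivity
  have huv₁ : ρ ^ k / ρ ≤ ρ ^ k := div_le_self hρk.le hρ1.le
  have hXle : X ≤ ρ ^ k / ρ := by
    rw [hXdef, div_eq_mul_inv, mul_comm]
    exact mul_le_mul_of_nonneg_left (inv_anti₀ hρ0 (by nlinarith)) hρk.le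
  have h2X : ρ * ρ ^ (k + 1) ≤ 2 * X := by
    rw [hXdef, pow_succ]
    have : ρ * (ρ ^ k * ρ) = (ρ ^ 5 * (ρ ^ 3)⁻¹) * ρ ^ k := by field_simp
    rw [this, ← mul_assoc]
    exact mul_le_mul_of_nonneg_right (by
      calc ρ ^ 5 * (ρ ^ 3)⁻¹ ≤ 2 * (ρ ^ 3)⁻¹ := mul_le_mul_of_nonneg_right hρ5 (by positivity)
        _ = 2 * (ρ ^ 3)⁻¹ := rfl) hρk.le
  have hsupp₁ : Icc (ρ ^ k / ρ) (ρ * ρ ^ k) ⊆ Icc X (2 * X) := by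
    intro x hx
    refine ⟨hXle.trans hx.1, hx.2.trans (le_trans ?_ h2X)⟩
    rw [pow_succ]; nlinarith
  have huv₂ : X ≤ ρ ^ (k + 1) := hXle.trans (huv₁.trans (by rw [pow_succ]; nlinarith))
  have hsupp₂ : Icc X (ρ * ρ ^ (k + 1)) ⊆ Icc X (2 * X) := fun x hx => ⟨hx.1, hx.2.trans h2X⟩
  -- the constituents
  have hB₁ : IsBumpOn X (fun x => (plateau ρ (ρ ^ k / ρ) (ρ ^ k) x : ℂ) * a x /
      ((4 * P * W : ℝ) : ℂ)) := by
    refine isBumpOn_of_bounds hX0 hP0 hW0 (plateau_contDiff ρ _ _)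
      (fun x hx => plateau_eq_zero_of_not_mem hρ1 hu₁ huv₁ fun hx' => hx (hsupp₁ hx'))
      (fun m hm x => ?_) ha.1 (fun x hx => a_bounds_on ha hY0 hX0 hx)
    refine (hD _ _ hu₁ huv₁ m hm x).trans ?_
    have e : ρ ^ k / (ρ ^ k / ρ) = ρ := by field_simp
    rw [e, hPdef]
    have : ρ ^ 2 ≤ ρ ^ 8 := pow_le_pow_right₀ hρ1.le (by norm_num)
    nlinarith [hD0, pow_pos hρ0 2]
  have hB₂ : IsBumpOn X (fun x => (plateau ρ X (ρ ^ (k + 1)) x : ℂ) *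
      (starRingEnd ℂ (a x) * ((ciL K (h * T / x) : ℝ) : ℂ)) / ((4 * P * (12 * W) : ℝ) : ℂ)) := by
    refine isBumpOn_of_bounds hX0 hP0 (by positivity) (plateau_contDiff ρ _ _)
      (fun x hx => plateau_eq_zero_of_not_mem hρ1 hX0 huv₂ fun hx' => hx (hsupp₂ hx'))
      (fun m hm x => ?_) ((contDiffOn_conj ha.1).mul (ell_bounds hK hc).1)
      (fun x hx => conj_ell_bounds_on hK ha hY0 hc hX0 hx)
    refine (hD _ _ hX0 huv₂ m hm x).trans (le_of_eq ?_)
    have e : ρ ^ (k + 1) / X = ρ ^ 4 := by rw [hXdef]; field_simp; ring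
    rw [e, hPdef]; ring
  -- (6.19) for the un-normalised constituents
  have h619 := shifted_bound_scaled hS hXhalf (by positivity : 0 < 4 * P * W)
    (by positivity : 0 < 4 * P * (12 * W)) hB₁ hB₂ hh
  -- identification of the sum
  have hpt : ∀ (x : ℝ) (u v : ℂ),
      u * a (x + h) * (v * starRingEnd ℂ (a x)) * ((ciL K (h * T / x) : ℝ) : ℂ) *
          (plateau ρ (ρ ^ k / ρ) (ρ ^ k) (x + h) : ℂ) =
        u * v * ((plateau ρ (ρ ^ k / ρ) (ρ ^ k) (x + h) : ℂ) * a (x + h)) *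
          ((plateau ρ X (ρ ^ (k + 1)) x : ℂ) *
            (starRingEnd ℂ (a x) * ((ciL K (h * T / x) : ℝ) : ℂ))) := by
    intro x u v
    by_cases hη : plateau ρ (ρ ^ k / ρ) (ρ ^ k) (x + h) = 0
    · rw [hη]; simp
    · rw [theta_eq_one hρ hk hη]; push_cast; ring
  have hsum : (∑' n : ℕ, lam (n + h) * a ((n : ℝ) + h) * starRingEnd ℂ (lam n * a n) *
        (ciL K (h * T / n) : ℂ) * (plateau ρ (ρ ^ k / ρ) (ρ ^ k) ((n : ℝ) + h) : ℂ)) =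
      ∑ n ∈ Finset.Icc 1 ⌊2 * X⌋₊, lam (n + h) * starRingEnd ℂ (lam n) *
        ((plateau ρ (ρ ^ k / ρ) (ρ ^ k) ((n : ℝ) + h) : ℂ) * a ((n : ℝ) + h)) *
        ((plateau ρ X (ρ ^ (k + 1)) n : ℂ) *
          (starRingEnd ℂ (a n) * ((ciL K (h * T / n) : ℝ) : ℂ))) := by
    rw [tsum_eq_sum (s := Finset.Icc 1 ⌊2 * X⌋₊)]
    · refine Finset.sum_congr rfl fun n _ => ?_
      rw [map_mul]
      exact hpt n (lam (n + h)) (starRingEnd ℂ (lam n))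
    · intro n hn
      rw [Finset.mem_Icc, not_and_or, not_le, not_le] at hn
      rcases hn with hn | hn
      · have : n = 0 := by omega
        subst this
        simp [ha0]
      · have hn' : 2 * X < n := lt_of_lt_of_le (Nat.lt_floor_add_one (2 * X)) (by exact_mod_cast hn)
        have hge : ρ * ρ ^ k ≤ (n : ℝ) + h := by
          have h0 : (0:ℝ) ≤ h := Nat.cast_nonneg h
          have : ρ * ρ ^ k ≤ 2 * X := by rw [pow_succ] at h2X; nlinarith
          linarith
        rw [plateau_eq_zero_of_ge hρ1 hu₁ huv₁ hge]; simp
  -- identification of the integral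
  have hint : (∫ x in Ioi (0:ℝ), a (x + h) * starRingEnd ℂ (a x) * (ciL K (h * T / x) : ℂ) *
        (plateau ρ (ρ ^ k / ρ) (ρ ^ k) (x + h) : ℂ)) =
      ∫ x : ℝ, ((plateau ρ (ρ ^ k / ρ) (ρ ^ k) (x + h) : ℂ) * a (x + h)) *
        ((plateau ρ X (ρ ^ (k + 1)) x : ℂ) *
          (starRingEnd ℂ (a x) * ((ciL K (h * T / x) : ℝ) : ℂ))) := by
    have hR : (∫ x : ℝ, ((plateau ρ (ρ ^ k / ρ) (ρ ^ k) (x + h) : ℂ) * a (x + h)) *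
        ((plateau ρ X (ρ ^ (k + 1)) x : ℂ) *
          (starRingEnd ℂ (a x) * ((ciL K (h * T / x) : ℝ) : ℂ)))) =
        ∫ x in Ioi (0:ℝ), ((plateau ρ (ρ ^ k / ρ) (ρ ^ k) (x + h) : ℂ) * a (x + h)) *
          ((plateau ρ X (ρ ^ (k + 1)) x : ℂ) *
            (starRingEnd ℂ (a x) * ((ciL K (h * T / x) : ℝ) : ℂ))) := by
      refine (setIntegral_eq_integral_of_forall_compl_eq_zero fun x hx => ?_).symm
      rw [mem_Ioi, not_lt] at hx
      have hle : x + h ≤ ρ ^ k / ρ := by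
        have : (h : ℝ) ≤ ρ ^ k / ρ := hk.trans (sub_le_self _ (by positivity))
        linarith
      rw [plateau_eq_zero_of_le hρ1 hu₁ huv₁ hle]; simp
    rw [hR]
    refine setIntegral_congr_fun measurableSet_Ioi fun x _ => ?_
    have h1 := hpt x 1 1
    simp only [one_mul] at h1
    exact h1
  rw [hsum, hint]
  refine h619.trans (le_of_eq ?_)
  have hW2 : ((1 + X / Y) ^ 8)⁻¹ = W * W := by rw [hWdef, ← mul_inv, ← pow_add]
  rw [hW2]; ring

end Piece

/-! ### The sum over the non-separated pieces -/

section Blocks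

variable {ρ : ℝ} (hρ : ρ = 9 / 8) {K : ℝ → ℝ} (hK : IsCIKernel K)
  {lam : ℕ → ℂ} {σ : ℕ → ℝ} {B₁ : ℝ} (hB₁ : 0 ≤ B₁) (hS : ShiftedConvolutionBound lam σ B₁)
  (hlam : ∀ n : ℕ, 1 ≤ n → ‖lam n‖ ≤ (Nat.divisors n).card)
  {T Y : ℝ} {a : ℝ → ℂ} (hT : 1 ≤ T) (hY : 2 ≤ Y) (ha : IsCutoff14 a Y) (ha0 : a 0 = 0)
  {h : ℕ} (hh : 1 ≤ h) {D : ℝ} (hD1 : 1 ≤ D)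
  (hD : ∀ u v : ℝ, 0 < u → u ≤ v → ∀ m : ℕ, m ≤ 2 → ∀ x : ℝ,
      |x| ^ m * |iteratedDeriv m (plateau ρ u v) x| ≤ ρ ^ 2 * D * (1 + (v / u) ^ 2))

include hρ hK hB₁ hS hT hY ha ha0 hh hD1 hD in
/-- **The non-separated pieces summed** (first error term of (6.27)): over any finite set of
non-separated pieces, `Σ_k |S_k − σ(h)I_k| ≤ 192P²G₀·Bτ(h)Y^{3/4}log²(3Y)` with
`G₀ = ρ^{3/4}/(ρ^{3/4}−1) + (1−ρ^{−21/4})⁻¹`. [cite: ConreyIwaniec2002, §6 (6.19), (6.27)] -/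
theorem large_block_bound (s : Finset ℕ) (hs : ∀ k ∈ s, (h : ℝ) ≤ ρ ^ k / ρ - ρ ^ k / ρ ^ 2) :
    ∑ k ∈ s, ‖(∑' n : ℕ, lam (n + h) * a ((n : ℝ) + h) * starRingEnd ℂ (lam n * a n) *
          (ciL K (h * T / n) : ℂ) * (plateau ρ (ρ ^ k / ρ) (ρ ^ k) ((n : ℝ) + h) : ℂ)) -
        (σ h : ℂ) * ∫ x in Ioi (0:ℝ), a (x + h) * starRingEnd ℂ (a x) * (ciL K (h * T / x) : ℂ) *
          (plateau ρ (ρ ^ k / ρ) (ρ ^ k) (x + h) : ℂ)‖ ≤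
      192 * (ρ ^ 2 * D * (1 + ρ ^ 8)) ^ 2 * B₁ * (Nat.divisors h).card *
        ((ρ ^ (3 / 4 : ℝ) / (ρ ^ (3 / 4 : ℝ) - 1) + (1 - ρ ^ (-(21 / 4) : ℝ))⁻¹) *
          Y ^ (3 / 4 : ℝ) * Real.log (3 * Y) ^ 2) := by
  obtain ⟨hρ1, hρ0, -, -, -⟩ := rho_facts hρ
  have hc : 0 < (ρ ^ 3)⁻¹ := by positivity
  have hs' : ∀ k ∈ s, 1 / 3 ≤ (ρ ^ 3)⁻¹ * ρ ^ k := fun k hk => by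
    have := (piece_scale hρ hh (hs k hk)).2; linarith
  refine (Finset.sum_le_sum fun k hk =>
    piece_bound hρ hK hS hT hY ha ha0 hh hD1 hD k (hs k hk)).trans ?_
  rw [← Finset.mul_sum]
  exact mul_le_mul_of_nonneg_left (sum_pieces_le hρ1 hc hY s hs') (by positivity)

end Blocks

end Thm61ShiftedPieces

end ConreyIwaniec2002

end Literature.NumberTheory.LFunctions

end
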